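import Literature.AlgebraicGeometry.Motives.MixedHodgeExtensionUnitInternalHomEvaluation
import Literature.AlgebraicGeometry.Motives.MixedHodgeStructureInternalHomMorphisms
import HarnessLib

/-!
# Naturality of Jannsen's `α : Ext¹(ℚ(0), Hom(A, B)) ≅ Ext¹(A, B)` in `A` and `B`

Jannsen, *Mixed Motives and Algebraic K-Theory* (LNM 1400), §9 Remark 9.3 a): `α` maps an extension
`0 → Hom(A, B) → E → ℤ → 0` to the push-out of `E ⊗ A` along the evaluation `Hom(A, B) ⊗ A → B`;
Carlson, *Extensions of mixed Hodge structures* (1980), §2(b) Prop. 1: "`Ext(∗, ∗)` is a functor,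
contravariant in the first variable, and covariant in the second"; Deligne, *Hodge II*, 1.1.12:
`Hom(f, g) : Hom(A, B) → Hom(A', B')`, `φ ↦ g ∘ φ ∘ f`, is a morphism of (bi)filtered objects (the
tree's `Hom.homMap f g`). This file proves that Jannsen's `α` (the tree's `Ext.alpha =
Ext.unitInternalHomEquivW`, `MixedHodgeExtensionUnitInternalHomEvaluation`) is an isomorphism of
BIFUNCTORS:

* §1 the complexified identity `homBaseChange (Hom(f, g)_ℂ h) = g_ℂ ∘ homBaseChange h ∘ f_ℂ` and, on
  Brylinski–Zucker's groups, **`JHomW.alpha (Hom(f, g)_* c) = f^* g_* (JHomW.alpha c)`**;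
* §2 **`Ext.alpha A' B' (Hom(f, g)_* x) = f^* g_* (Ext.alpha A B x)`** (`Ext.alpha_pushoutMapW_homMap`),
  the same for `Ext.unitInternalHomEquivW` and for its inverse, the one-variable cases, and the
  version on classes of extensions.

All statements proved; no named facts.

## References

* [Jannsen1990MixedMotives] U. Jannsen, Mixed Motives and Algebraic K-Theory, LNM 1400 (1990), §9
  Remark 9.3 a) (store `book:jannsennd-mixed-motives-algebraic-k-theory`, chunk p0100).
* [Carlson1980] J. A. Carlson, Extensions of mixed Hodge structures (1980), §2(b) Prop. 1.
* [DeligneHodgeII1971] P. Deligne, Théorie de Hodge II, 1.1.12.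
* [MacLane1963Homology] S. Mac Lane, Homology (1963), Ch. III §1 Lemmas 1.2, 1.4.
-/

open scoped TensorProduct

noncomputable section

namespace Literature.AlgebraicGeometry.Motives

namespace MixedHodgeStructure

open HodgeStructure (ofRat ofRat_apply tate homBaseChange homBaseChange_tmul)

universe u v u' v' w

variable {VA : Type u} [AddCommGroup VA] [Module ℚ VA] [FiniteDimensional ℚ VA]
variable {VB : Type v} [AddCommGroup VB] [Module ℚ VB] [FiniteDimensional ℚ VB]
variable {VA' : Type u'} [AddCommGroup VA'] [Module ℚ VA'] [FiniteDimensional ℚ VA']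
variable {VB' : Type v'} [AddCommGroup VB'] [Module ℚ VB'] [FiniteDimensional ℚ VB']
variable {VE : Type w} [AddCommGroup VE] [Module ℚ VE] [FiniteDimensional ℚ VE]

/-! ### §1 `Hom(f, g)` under complexification; naturality of `α` on `J⁰W₀Hom` -/

section JLevel

variable {A : MixedHodgeStructure VA} {B : MixedHodgeStructure VB}
variable {A' : MixedHodgeStructure VA'} {B' : MixedHodgeStructure VB'}

/-- **`homBaseChange (Hom(f, g)_ℂ h) = g_ℂ ∘ homBaseChange h ∘ f_ℂ`**: the comparison
`Hom(A, B)_ℂ ≅ Hom_ℂ(A_ℂ, B_ℂ)` intertwines `Hom(f, g) ⊗ ℂ` with `φ ↦ g_ℂ ∘ φ ∘ f_ℂ`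
(on `c ⊗ φ` both give `c • (g ∘ φ ∘ f)_ℂ`; Deligne, Hodge II, 1.1.12). [cite: DeligneHodgeII1971, 1.1.12] -/
theorem homBaseChange_homMap_baseChange (f : Hom A' A) (g : Hom B B') (h : ℂ ⊗[ℚ] (VA →ₗ[ℚ] VB)) :
    homBaseChange VA' VB' ((Hom.homMap f g).toLinearMap.baseChange ℂ h) =
      (g.toLinearMap.baseChange ℂ ∘ₗ homBaseChange VA VB h) ∘ₗ f.toLinearMap.baseChange ℂ := by
  induction h using TensorProduct.induction_on with
  | zero => simp only [map_zero, LinearMap.comp_zero, LinearMap.zero_comp]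
  | add x y hx hy => simp only [map_add, hx, hy, LinearMap.comp_add, LinearMap.add_comp]
  | tmul c φ =>
    rw [LinearMap.baseChange_tmul, homBaseChange_tmul, homBaseChange_tmul, Hom.homMap_toLinearMap_apply,
      LinearMap.baseChange_comp, LinearMap.baseChange_comp, LinearMap.comp_smul, LinearMap.smul_comp,
      LinearMap.comp_assoc]

omit [FiniteDimensional ℚ VA] [FiniteDimensional ℚ VB] [FiniteDimensional ℚ VB'] in
/-- The ambient class of `g_* c` (by `rfl`). [cite: Carlson1980, §2(b) Prop. 1] -/
theorem JHomW.coe_postcomp (g : Hom B B') (c : JHomW A B) :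
    ((JHomW.postcomp A g c : JHomW A B') : JWQuot A B') = JHomW.postcompQuot A g (c : JWQuot A B) :=
  rfl

omit [FiniteDimensional ℚ VA] [FiniteDimensional ℚ VB] [FiniteDimensional ℚ VA'] in
/-- The ambient class of `f^* c` (by `rfl`). [cite: Carlson1980, §2(b) Prop. 1] -/
theorem JHomW.coe_precomp (f : Hom A' A) (c : JHomW A B) :
    ((JHomW.precomp B f c : JHomW A' B) : JWQuot A' B) = JHomW.precompQuot B f (c : JWQuot A B) :=
  rfl

variable (A B A' B') in
/-- **Naturality of `α` on Brylinski–Zucker's groups**: for `f : A' → A`, `g : B → B'`,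
`α (Hom(f, g)_* [ψ]) = f^* g_* (α [ψ])` in `J⁰W₀Hom(A', B')` — both are the class of
`g_ℂ ∘ homBaseChange(ψ(1 ⊗ 1)) ∘ f_ℂ`. [cite: Jannsen1990MixedMotives, §9 Remark 9.3 a)]
[cite: Carlson1980, §2(b) Prop. 1] -/
theorem JHomW.alpha_postcomp_homMap (f : Hom A' A) (g : Hom B B')
    (c : JHomW (tate (-0)).toMixedHodgeStructure (hom A B)) :
    JHomW.alpha A' B' (JHomW.postcomp (tate (-0)).toMixedHodgeStructure (Hom.homMap f g) c) =
      JHomW.precomp B' f (JHomW.postcomp A g (JHomW.alpha A B c)) := by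
  obtain ⟨ψ, rfl⟩ := JHomW.mk_surjective c
  apply Subtype.ext
  rw [JHomW.postcomp_mk, JHomW.coe_alpha_mk, JHomW.coe_precomp, JHomW.coe_postcomp, JHomW.coe_alpha_mk,
    JHomW.postcompQuot_mk, JHomW.precompQuot_mk]
  exact congrArg _ (homBaseChange_homMap_baseChange f g _)

end JLevel

/-! ### §2 Naturality of `α` and of `unitInternalHomEquivW` on `Ext` -/

section ExtLevel

variable (A : MixedHodgeStructure VA) (B : MixedHodgeStructure VB)
variable (A' : MixedHodgeStructure VA') (B' : MixedHodgeStructure VB')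

/-- **Jannsen's `α` is natural in both variables**: for `f : A' → A`, `g : B → B'` and
`x ∈ Ext(ℚ(0), Hom(A, B))`, `α (Hom(f, g)_* x) = f^* g_* (α x)` in `Ext(A', B')` — `α` is an
isomorphism of bifunctors `Ext¹(ℚ(0), Hom(−, −)) ≅ Ext¹(−, −)` (contravariant, covariant).
[cite: Jannsen1990MixedMotives, §9 Remark 9.3 a)] [cite: Carlson1980, §2(b) Prop. 1] -/
theorem Ext.alpha_pushoutMapW_homMap (f : Hom A' A) (g : Hom B B')
    (x : Ext (tate (-0)).toMixedHodgeStructure (hom A B)) :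
    Ext.alpha A' B' (Ext.pushoutMapW (Hom.homMap f g) x) =
      Ext.pullbackMapW f (Ext.pushoutMapW g (Ext.alpha A B x)) :=
  Ext.extEquivJHomW.injective (by
    rw [Ext.extEquivJHomW_alpha, Ext.extEquivJHomW_pushoutMapW, ← Ext.extEquivJHomW_apply,
      JHomW.alpha_postcomp_homMap, Ext.extEquivJHomW_pullbackMapW, ← Ext.extEquivJHomW_apply,
      Ext.extEquivJHomW_pushoutMapW, ← Ext.extEquivJHomW_apply, Ext.extEquivJHomW_alpha])

/-- **`unitInternalHomEquivW` is natural in both variables**: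
`unitInternalHomEquivW A' B' (Hom(f, g)_* x) = f^* g_* (unitInternalHomEquivW A B x)`.
[cite: Jannsen1990MixedMotives, §9 Remark 9.3 a)] [cite: Carlson1980, §2(b) Prop. 1] -/
theorem Ext.unitInternalHomEquivW_pushoutMapW_homMap (f : Hom A' A) (g : Hom B B')
    (x : Ext (tate (-0)).toMixedHodgeStructure (hom A B)) :
    Ext.unitInternalHomEquivW A' B' (Ext.pushoutMapW (Hom.homMap f g) x) =
      Ext.pullbackMapW f (Ext.pushoutMapW g (Ext.unitInternalHomEquivW A B x)) := by
  rw [← Ext.alpha_eq_unitInternalHomEquivW, ← Ext.alpha_eq_unitInternalHomEquivW,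
    Ext.alpha_pushoutMapW_homMap]

/-- Naturality in the target alone: `unitInternalHomEquivW A B' (Hom(A, g)_* x) = g_* (unitInternalHomEquivW A B x)`.
[cite: Carlson1980, §2(b) Prop. 1] -/
theorem Ext.unitInternalHomEquivW_pushoutMapW_homMap_id (g : Hom B B')
    (x : Ext (tate (-0)).toMixedHodgeStructure (hom A B)) :
    Ext.unitInternalHomEquivW A B' (Ext.pushoutMapW (Hom.homMap (Hom.id A) g) x) =
      Ext.pushoutMapW g (Ext.unitInternalHomEquivW A B x) := by
  rw [Ext.unitInternalHomEquivW_pushoutMapW_homMap, Ext.pullbackMapW_id]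

/-- Naturality in the source alone: `unitInternalHomEquivW A' B (Hom(f, B)_* x) = f^* (unitInternalHomEquivW A B x)`.
[cite: Carlson1980, §2(b) Prop. 1] -/
theorem Ext.unitInternalHomEquivW_pushoutMapW_homMap_id' (f : Hom A' A)
    (x : Ext (tate (-0)).toMixedHodgeStructure (hom A B)) :
    Ext.unitInternalHomEquivW A' B (Ext.pushoutMapW (Hom.homMap f (Hom.id B)) x) =
      Ext.pullbackMapW f (Ext.unitInternalHomEquivW A B x) := by
  rw [Ext.unitInternalHomEquivW_pushoutMapW_homMap, Ext.pushoutMapW_id]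

/-- **Naturality of the inverse**: `unitInternalHomEquivW⁻¹ (f^* g_* y) = Hom(f, g)_* (unitInternalHomEquivW⁻¹ y)`.
[cite: Jannsen1990MixedMotives, §9 Remark 9.3 a)] [cite: Carlson1980, §2(b) Prop. 1] -/
theorem Ext.unitInternalHomEquivW_symm_pullbackMapW_pushoutMapW (f : Hom A' A) (g : Hom B B') (y : Ext A B) :
    (Ext.unitInternalHomEquivW A' B').symm (Ext.pullbackMapW f (Ext.pushoutMapW g y)) =
      Ext.pushoutMapW (Hom.homMap f g) ((Ext.unitInternalHomEquivW A B).symm y) := by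
  apply (Ext.unitInternalHomEquivW A' B').injective
  rw [Equiv.apply_symm_apply, Ext.unitInternalHomEquivW_pushoutMapW_homMap, Equiv.apply_symm_apply]

/-- The inverse, target alone: `unitInternalHomEquivW⁻¹ (g_* y) = Hom(A, g)_* (unitInternalHomEquivW⁻¹ y)`.
[cite: Carlson1980, §2(b) Prop. 1] -/
theorem Ext.unitInternalHomEquivW_symm_pushoutMapW (g : Hom B B') (y : Ext A B) :
    (Ext.unitInternalHomEquivW A B').symm (Ext.pushoutMapW g y) =
      Ext.pushoutMapW (Hom.homMap (Hom.id A) g) ((Ext.unitInternalHomEquivW A B).symm y) := by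
  rw [← Ext.unitInternalHomEquivW_symm_pullbackMapW_pushoutMapW, Ext.pullbackMapW_id]

/-- The inverse, source alone: `unitInternalHomEquivW⁻¹ (f^* y) = Hom(f, B)_* (unitInternalHomEquivW⁻¹ y)`.
[cite: Carlson1980, §2(b) Prop. 1] -/
theorem Ext.unitInternalHomEquivW_symm_pullbackMapW (f : Hom A' A) (y : Ext A B) :
    (Ext.unitInternalHomEquivW A' B).symm (Ext.pullbackMapW f y) =
      Ext.pushoutMapW (Hom.homMap f (Hom.id B)) ((Ext.unitInternalHomEquivW A B).symm y) := by
  rw [← Ext.unitInternalHomEquivW_symm_pullbackMapW_pushoutMapW, Ext.pushoutMapW_id]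

/-- `α` commutes with `Hom(f, g)_*` and `f^* g_*` in the other order too: `α (Hom(f,g)_* x) = g_* f^* (α x)`.
[cite: MacLane1963Homology, Ch. III §1 Lemmas 1.2, 1.4] -/
theorem Ext.alpha_pushoutMapW_homMap' (f : Hom A' A) (g : Hom B B')
    (x : Ext (tate (-0)).toMixedHodgeStructure (hom A B)) :
    Ext.alpha A' B' (Ext.pushoutMapW (Hom.homMap f g) x) =
      Ext.pushoutMapW g (Ext.pullbackMapW f (Ext.alpha A B x)) := by
  rw [Ext.alpha_pushoutMapW_homMap, Ext.pushoutMapW_pullbackMapW]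

omit [FiniteDimensional ℚ VE] in
/-- **Functoriality squares for classes of extensions**: if `α [F] = [E]` then
`α [Hom(f, g)_* F] = [f^* g_* E]`. [cite: Jannsen1990MixedMotives, §9 Remark 9.3 a)] -/
theorem Ext.unitInternalHomEquivW_mkOfW_pushout_homMap {VE' : Type*} [AddCommGroup VE'] [Module ℚ VE']
    (f : Hom A' A) (g : Hom B B') (F : Extension (tate (-0)).toMixedHodgeStructure (hom A B) VE)
    (E : Extension A B VE') (h : Ext.unitInternalHomEquivW A B (Ext.mkOfW F) = Ext.mkOfW E) :
    Ext.unitInternalHomEquivW A' B' (Ext.mkOfW (F.pushout (Hom.homMap f g))) =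
      Ext.mkOfW ((E.pushout g).pullback f) := by
  rw [← Ext.pushoutMapW_mkOfW, Ext.unitInternalHomEquivW_pushoutMapW_homMap, h, Ext.pushoutMapW_mkOfW,
    Ext.pullbackMapW_mkOfW]

end ExtLevel

end MixedHodgeStructure

end Literature.AlgebraicGeometry.Motives

end
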